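import Literature.Claims.NS.SuZhen2026
import Literature.Analysis.FluidPDE.AzimuthalDivergenceFree
import Summits.NavierStokesRegularity.NavierStokesRegularity.Theorems.SoloRefuteSuZhen2026
import HarnessLib

/-!
# C140 `SuZhen2026` — salvage: kernel census of the remaining typed steps (records-grade)

Skeleton `Literature.Claims.NS.SuZhen2026` (ns-claims-typist-5 g6; p519502, rev 2 p521841). Row #124
ADJUDICATED 2026-08-27T10:26:54Z: first failing step = `Step5a_Smooth` (§5 p.8 l.152), class = false
lemma, by `…Theorems.SuZhen2026.not_Step5a_Smooth` (kit refuter-7 g3, p521960/p522861). This file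
decides, in the kernel, the typed steps the kit of record leaves open or records only in prose — it
keys NO verdict and touches no token:

* `step5c_holds : Step5c_DivFree A` — §5 p.8 l.153 «divergence-free: ∇·u ≡ 0» is TRUE AS TYPED for
  the printed field `u = u_θ(r,z) e_θ`, every `A`: purely azimuthal axisymmetric fields are
  divergence free at every point of `ℝ³` in the tree's junk-valued sense (tree:
  `Literature.Analysis.FluidPDE.isDivFree_smul_eTheta`, MB 2002 §2.3.3) — so l.153 is NOT where the
  chain breaks;
* `isLocalSolution_degenerate` — for `T ≤ 0` the constant pair `(datum A, 0)` inhabits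
  `Chae2007.IsLocalSolution 1 T (datum A)` (every clause vacuous on `Ico 0 T = ∅`), whence
  `not_Step6c_ExpIntegral : ¬ Step6c_ExpIntegral A` (the rev-1 face of p.9 l.179 is false AS TYPED
  only through the degenerate horizon `T = 0` — REF RETYPE v1c typing-width artefact, never a
  locator; the honest faces are rev 2's `Step6cP_ExpIntegral` / `Step6cR_ExpIntegralReal`);
* `step4_holds`, `step5hSol_holds`, `step6_holds`, `step6b_holds` — the solution-grain faces §4
  l.144, l.162-as-consumed, §6 l.165–173, l.175–178 hold VACUOUSLY as typed: by the landed
  `not_Step5a_Smooth` no typed local solution from the printed field has a horizon `0 < T`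
  (`horizon_nonpos`), and on `T ≤ 0` their conclusions range over `Ioo/Ico 0 T = ∅`.

ns-claims-salvage-p2 g5, 2026-08-27 (salvage lane, C140 SALVAGE FINAL).

WHAT THIS IS NOT: not a claim about NS regularity or blow-up; not a claim about any author beyond
the typed locator.
-/

noncomputable section

open Set Function Filter MeasureTheory
open scoped Topology ENNReal NNReal ContDiff

namespace Summit.NavierStokesRegularity.NavierStokesRegularity.Theorems.SuZhen2026Salvage

open Literature.Analysis.FluidPDE Literature.Claims.NS.SuZhen2026
open Literature.Claims.NS.Chae2007 (IsLocalSolution)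
open Summit.NavierStokesRegularity.NavierStokesRegularity.Theorems.SuZhen2026 (not_Step5a_Smooth)

/-- **`Step5c_DivFree A` HOLDS for every amplitude** (§5 p.8 l.153 «divergence-free: ∇·u ≡ 0»): the
printed field `datum A = u_θ(r,z) • e_θ` has an axisymmetric scalar amplitude, so it is divergence
free at every point (`isDivFree_smul_eTheta`). [cite: SuZhen2026, §5 p.8 l.153] -/
theorem step5c_holds (A : ℝ) : Step5c_DivFree A :=
  isDivFree_smul_eTheta (c := fun x => uTheta A (cylRadius x) (x 2))
    (fun θ x => by simp only [cylRadius_rotZ, rotZ_apply_two])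

/-- **Degenerate horizons are inhabited**: for `T ≤ 0` the constant pair `(datum A, 0)` is a typed
«local regular solution on `[0,T)`» — `Ico 0 T = ∅`, so smoothness, the equations and the Sobolev
bounds are vacuous and `u 0 = datum A` is `rfl`. [cite: SuZhen2026, Thm 6.1 p.9 l.182–183] -/
theorem isLocalSolution_degenerate (A : ℝ) {T : ℝ} (hT : T ≤ 0) :
    IsLocalSolution 1 T (datum A) (fun _ => datum A) (fun _ _ => 0) where
  isClassical :=
    { smooth_velocity := by
        simp only [IsSmoothSpaceTimeOn, Ico_eq_empty (not_lt.2 hT), empty_prod]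
        exact contDiffOn_empty
      smooth_pressure := by
        simp only [IsSmoothSpaceTimeOn, Ico_eq_empty (not_lt.2 hT), empty_prod]
        exact contDiffOn_empty
      momentum := fun t ht => absurd ht (by simp [Ico_eq_empty (not_lt.2 hT)])
      divFree := fun t ht => absurd ht (by simp [Ico_eq_empty (not_lt.2 hT)]) }
  initial := rfl
  sobolev := fun T'' hT'' n => ⟨0, fun t ht => absurd ht (by
    simp [Icc_eq_empty (not_le.2 (lt_of_lt_of_le hT'' hT))])⟩

/-- **`Step6c_ExpIntegral A` is false AS TYPED, for every `A`** — only by the degenerate instance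
`T = 0`: the lower integral of `c₁e^{αt/2}` over `Ioo 0 0 = ∅` is `0`, not `⊤` (typing-width
artefact, REF RETYPE v1c; not a locator). [cite: SuZhen2026, §6 p.9 l.179] -/
theorem not_Step6c_ExpIntegral (A : ℝ) : ¬ Step6c_ExpIntegral A := by
  intro h
  have := h 0 (fun _ => datum A) (fun _ _ => 0) (isLocalSolution_degenerate A le_rfl) 1 1
    one_pos one_pos
  simp at this

/-- **No positive horizon from the printed field**: every typed local solution with initial slice
`datum A` has `T ≤ 0` (for `T > 0` the slice `u 0` of a classical solution is `C^∞`, contradicting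
the landed `not_Step5a_Smooth`). [cite: SuZhen2026, §5 p.8 l.152; Thm 6.1 p.9 l.182–183] -/
theorem horizon_nonpos {A T : ℝ} {u : ℝ → E3 → E3} {p : ℝ → E3 → ℝ}
    (hsol : IsLocalSolution 1 T (datum A) u p) : T ≤ 0 := by
  by_contra hT
  push Not at hT
  have h0 := hsol.isClassical.contDiff_velocity (t := 0) ⟨le_rfl, hT⟩
  rw [hsol.initial] at h0
  exact not_Step5a_Smooth A h0

/-- `Step4_KeyIneq A` holds VACUOUSLY (every typed local solution has `T ≤ 0`, so `Ioo 0 T = ∅`).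
[cite: SuZhen2026, §4 p.7 l.136–145] -/
theorem step4_holds (A : ℝ) : Step4_KeyIneq A := by
  intro T u p hsol c₀ _ x₀ r _ t ht
  exact absurd ht.2 (not_lt.2 ((horizon_nonpos hsol).trans ht.1.le))

/-- `Step5h_StretchSol A` holds VACUOUSLY (take `c₀ = Ctot + 1`; `Ico 0 T = ∅`).
[cite: SuZhen2026, §5 p.8 l.162; §4 p.7 l.146–147] -/
theorem step5hSol_holds (A : ℝ) : Step5h_StretchSol A := by
  intro T u p hsol
  exact ⟨Ctot + 1, by linarith, fun t ht => absurd ht.2 (not_lt.2 ((horizon_nonpos hsol).trans ht.1))⟩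

/-- `Step6_Growth A` holds VACUOUSLY (`Ico 0 T = ∅`). [cite: SuZhen2026, §6 p.8 l.165 – p.9 l.173] -/
theorem step6_holds (A : ℝ) : Step6_Growth A := by
  intro T u p hsol α _ _ t ht
  exact absurd ht.2 (not_lt.2 ((horizon_nonpos hsol).trans ht.1))

/-- `Step6b_SupGrowth A` holds VACUOUSLY (take `c₁ = 1`; `Ico 0 T = ∅`).
[cite: SuZhen2026, §6 p.9 l.175–178] -/
theorem step6b_holds (A : ℝ) : Step6b_SupGrowth A := by
  intro T u p hsol α _ _
  exact ⟨1, one_pos, fun t ht => absurd ht.2 (not_lt.2 ((horizon_nonpos hsol).trans ht.1))⟩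

/-- Type-exact probes against the skeleton decls. [cite: SuZhen2026, §5 p.8 l.153] -/
example (A : ℝ) : Literature.Claims.NS.SuZhen2026.Step5c_DivFree A := step5c_holds A
example (A : ℝ) : ¬ Literature.Claims.NS.SuZhen2026.Step6c_ExpIntegral A := not_Step6c_ExpIntegral A
example (A : ℝ) : Literature.Claims.NS.SuZhen2026.Step4_KeyIneq A := step4_holds A

end Summit.NavierStokesRegularity.NavierStokesRegularity.Theorems.SuZhen2026Salvage
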